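import Summits.AnomalousDissipation.AnomalousDissipation.Theorems.MarginalStabilityChainChainRealisationStubLiftBoundsC
import Literature.Analysis.FunctionSpaces.TorusSpaceTimeKernel
import Literature.Analysis.FunctionSpaces.TorusClassicalNSRestart
import Literature.Analysis.FunctionSpaces.TorusMollifierEstimates
import HarnessLib

/-!
# Stub `stub_liftBounds` of the line `SketchIdeator2` (card `separatrix-flux-pinning`)
# (crux stmt-AnomalousDissipation-14249, `MarginalStabilityChain.ChainRealisation`)

**All space–time derivatives of the lifts of a forward classical solution are bounded on
`(0, ∞) × ℝ³`.** For a forward classical Navier–Stokes solution `(u, p)` on `[0, ∞) × T³` with a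
steady smooth force and `sup_{t ≥ 0} E_k(u(t)) < ∞` for every `k` (`Torus.sobolevEnergy`), every
`‖D^m (stLift u)‖` and every `‖D^m (stLift p̃)‖`, `p̃ = p − p(·, 0)` the pressure normalised at
the origin, is bounded on `Ioi 0 ×ˢ univ` (honest `iteratedFDeriv`: the lifts are `C^∞` on a
neighbourhood of each such point).

Proof. Part C bounds all `∂^w ∂ₜʲ u` and all `∂^w ∇∂ₜʲ p̃` on `[0, ∞) × T³`; the words of `∂ₜʲ p̃`
itself follow (`liftB_pressure_words`: positive-length words are words of `∇∂ₜʲp̃`, and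
`∂ₜʲ p̃(t, ·)` vanishes at the origin, so it is bounded by the mean value inequality along the
lift on the fundamental cube). Then (`liftB_iteratedFDerivWithin_bound`, induction on `m` over
all value spaces): the derivative of the space–time lift within `Ici 0 ×ˢ univ` is the lift of the
field `∂ₜU ⊗ dt + ∑ᵢ ∂ᵢU ⊗ dyᵢ` (`Torus.IsSmoothSpaceTimeOn.fderivWithin_stLift`), whose iterated time
and word derivatives are again bounded (`∂ₜ` commutes with `∂ᵢ`, part A), and
`‖D^{m+1} f‖ = ‖D^m (Df)‖`; on the open set `Ioi 0 ×ˢ univ` the within-derivative is the honest one.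

The statement is the registered stub verbatim, with the skeleton's local notations
`𝕋³ = UnitAddTorus (Fin 3)`, `E³ = EuclideanSpace ℝ (Fin 3)` written out (no notation is declared).

References: C. Foias, O. Manley, R. Rosa, R. Temam, *Navier–Stokes Equations and Turbulence*,
CUP 2001, Ch. II App. A §A.5; P. Constantin, C. Foias, *Navier–Stokes Equations*, Univ. Chicago
Press 1988, Ch. 13.
-/

-- `Summit.<Summit>.<Problem>` is the tree's mandated summit-side namespace (CONVENTIONS §2); for this
-- single-conjunct summit the two coincide, so the duplicate is deliberate.
set_option linter.dupNamespace false

noncomputable section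

open MeasureTheory Set Filter Topology Function
open scoped InnerProductSpace ContDiff
open Literature.Analysis.FunctionSpaces Literature.Analysis.FunctionSpaces.Torus
open Literature.Analysis.FluidPDE.Torus

namespace Summit.AnomalousDissipation.AnomalousDissipation.Theorems.ChainRealisation.SeparatrixFluxPinning

/-- Sanity check: with the opens above, `stLift` on torus fields is `Torus.stLift`. -/
example : (stLift : (ℝ → UnitAddTorus (Fin 3) → EuclideanSpace ℝ (Fin 3)) → ℝ × EuclideanSpace ℝ (Fin 3) → EuclideanSpace ℝ (Fin 3)) = Torus.stLift := rfl

/-- Sanity check: with the opens above, `sobolevEnergy` is `Torus.sobolevEnergy` (all words). -/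
example : (sobolevEnergy : ℕ → (UnitAddTorus (Fin 3) → EuclideanSpace ℝ (Fin 3)) → ℝ) = Literature.Analysis.FluidPDE.Torus.sobolevEnergy := rfl

/-! ## The words of the normalised pressure -/

/-- `‖repr x‖ ≤ √3` for the fundamental-domain representative of `x ∈ T³`. -/
theorem liftB_norm_repr_le (x : UnitAddTorus (Fin 3)) : ‖repr x‖ ≤ Real.sqrt 3 := by
  rw [EuclideanSpace.norm_eq]
  refine Real.sqrt_le_sqrt ?_
  calc ∑ i, ‖repr x i‖ ^ 2 ≤ ∑ _i : Fin 3, (1 : ℝ) := Finset.sum_le_sum fun i _ => by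
        have h := repr_apply_mem_Ico x i
        rw [Real.norm_eq_abs, sq_abs]
        nlinarith [h.1, h.2]
    _ = 3 := by simp

/-- A smooth scalar function on `T³` vanishing at the origin is bounded by `√3` times a bound of
its gradient (mean value inequality along the lift on the fundamental cube). -/
theorem liftB_abs_le_of_gradient {g : UnitAddTorus (Fin 3) → ℝ} (hg : IsSmooth g) (h0 : g 0 = 0) {C : ℝ}
    (hC : ∀ x, ‖gradient g x‖ ≤ C) (x : UnitAddTorus (Fin 3)) : |g x| ≤ Real.sqrt 3 * C := by
  have hC0 : 0 ≤ C := (norm_nonneg _).trans (hC 0)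
  have hD : ∀ y ∈ (univ : Set (EuclideanSpace ℝ (Fin 3))), DifferentiableAt ℝ (lift g) y := fun y _ =>
    (ContDiff.differentiable hg (by simp)).differentiableAt
  have hbound : ∀ y ∈ (univ : Set (EuclideanSpace ℝ (Fin 3))), ‖_root_.fderiv ℝ (lift g) y‖ ≤ C := by
    intro y _
    rw [fderiv_lift]
    refine ContinuousLinearMap.opNorm_le_bound _ hC0 fun v => ?_
    rw [← Torus.inner_gradient_left]
    exact (abs_real_inner_le_norm _ _).trans (mul_le_mul_of_nonneg_right (hC _) (norm_nonneg _))
  have h := convex_univ.norm_image_sub_le_of_norm_fderiv_le hD hbound (mem_univ 0) (mem_univ (repr x))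
  rw [lift_repr, lift_apply, proj_zero, h0, sub_zero, sub_zero, Real.norm_eq_abs] at h
  calc |g x| ≤ C * ‖repr x‖ := h
    _ ≤ C * Real.sqrt 3 := mul_le_mul_of_nonneg_left (liftB_norm_repr_le x) hC0
    _ = Real.sqrt 3 * C := mul_comm _ _

/-- **Every `∂^w ∂ₜʲ p̃` is bounded on `[0, ∞) × T³`** for a pressure `p̃` normalised at the origin
(`p̃(s, 0) = 0`): words of positive length are words of `∇∂ₜʲ p̃` (part C), and `∂ₜʲ p̃(t, ·)`
vanishes at the origin. -/
theorem liftB_pressure_words {ν : ℝ} {F : UnitAddTorus (Fin 3) → EuclideanSpace ℝ (Fin 3)}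
    {u : ℝ → UnitAddTorus (Fin 3) → EuclideanSpace ℝ (Fin 3)} {q : ℝ → UnitAddTorus (Fin 3) → ℝ}
    (hsol : IsClassicalNSSolutionOn (Ici 0) ν (fun _ => F) u q) (hF : IsSmooth F)
    (h0 : ∀ k : ℕ, ∃ C : ℝ, ∀ t : ℝ, 0 ≤ t → sobolevEnergy k (u t) ≤ C) (hq0 : ∀ s, q s 0 = 0)
    (j : ℕ) (w : List (Fin 3)) :
    ∃ C : ℝ, ∀ t ∈ Ici (0 : ℝ), ∀ x : UnitAddTorus (Fin 3), ‖wordDeriv w (((timeDerivWithin (Ici 0))^[j] q) t) x‖ ≤ C := by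
  have hP : IsSmoothSpaceTimeOn (Ici 0) ((timeDerivWithin (Ici 0))^[j] q) :=
    hsol.smooth_pressure.iterate_timeDerivWithin (uniqueDiffOn_Ici 0) j
  rcases List.eq_nil_or_concat' w with rfl | ⟨w', i, rfl⟩
  · obtain ⟨C, hC⟩ := liftB_sup_words_pressure_grad hsol hF h0 j []
    refine ⟨Real.sqrt 3 * C, fun t ht x => ?_⟩
    have hg : IsSmooth (((timeDerivWithin (Ici 0))^[j] q) t) := hP.isSmooth_slice ht
    have hg0 : ((timeDerivWithin (Ici 0))^[j] q) t 0 = 0 := by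
      rw [iterate_timeDerivWithin_apply]
      simp only [hq0]
      rw [iteratedDerivWithin_const]
      split_ifs <;> rfl
    rw [wordDeriv_nil, Real.norm_eq_abs]
    exact liftB_abs_le_of_gradient hg hg0 (fun y => hC t ht y) x
  · obtain ⟨C, hC⟩ := liftB_sup_words_pressure_grad hsol hF h0 j w'
    refine ⟨C, fun t ht x => ?_⟩
    have hg : IsSmooth (((timeDerivWithin (Ici 0))^[j] q) t) := hP.isSmooth_slice ht
    have e : partialDeriv i (((timeDerivWithin (Ici 0))^[j] q) t) = fun y => gradient (((timeDerivWithin (Ici 0))^[j] q) t) y i :=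
      funext fun y => (gradient_apply (hg.isContDiff (by simp)) y i).symm
    rw [wordDeriv_concat, e, ← liftB_wordDeriv_apply_coord hg.gradient i w' x]
    exact (PiLp.norm_apply_le _ i).trans (hC t ht x)

/-! ## From word bounds to bounds of the Fréchet derivatives of the space–time lift -/

section Lift

variable {G : Type} [NormedAddCommGroup G] [NormedSpace ℝ G]

/-- The rank-one map `c ↦ dt ⊗ c`. -/
theorem liftB_Phi0_apply (c : G) (a : ℝ) (v : EuclideanSpace ℝ (Fin 3)) :
    ContinuousLinearMap.smulRightL ℝ (ℝ × EuclideanSpace ℝ (Fin 3)) G (ContinuousLinearMap.fst ℝ ℝ (EuclideanSpace ℝ (Fin 3))) c (a, v) = a • c := by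
  simp

/-- The rank-one maps `c ↦ dyᵢ ⊗ c`. -/
theorem liftB_Phi_apply (i : Fin 3) (c : G) (a : ℝ) (v : EuclideanSpace ℝ (Fin 3)) :
    ContinuousLinearMap.smulRightL ℝ (ℝ × EuclideanSpace ℝ (Fin 3)) G
      ((EuclideanSpace.proj i).comp (ContinuousLinearMap.snd ℝ ℝ (EuclideanSpace ℝ (Fin 3)))) c (a, v) = v i • c := by
  simp

/-- **The derivative of the space–time lift within `[0, ∞) × ℝ³` is the lift of
`dt ⊗ ∂ₜU + ∑ᵢ dyᵢ ⊗ ∂ᵢU`.** -/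
theorem liftB_fderivWithin_stLift {U : ℝ → UnitAddTorus (Fin 3) → G} (hU : IsSmoothSpaceTimeOn (Ici 0) U)
    {t : ℝ} (ht : t ∈ Ici (0 : ℝ)) (y : EuclideanSpace ℝ (Fin 3)) :
    fderivWithin ℝ (stLift U) (Ici 0 ×ˢ univ) (t, y) =
      stLift (fun s x => ContinuousLinearMap.smulRightL ℝ (ℝ × EuclideanSpace ℝ (Fin 3)) G
          (ContinuousLinearMap.fst ℝ ℝ (EuclideanSpace ℝ (Fin 3))) (timeDerivWithin (Ici 0) U s x) +
        ∑ i, ContinuousLinearMap.smulRightL ℝ (ℝ × EuclideanSpace ℝ (Fin 3)) G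
          ((EuclideanSpace.proj i).comp (ContinuousLinearMap.snd ℝ ℝ (EuclideanSpace ℝ (Fin 3)))) (partialDeriv i (U s) x))
        (t, y) := by
  rw [hU.fderivWithin_stLift (uniqueDiffOn_Ici 0) ht y, stLift_apply]
  refine ContinuousLinearMap.ext fun z => ?_
  obtain ⟨a, v⟩ := z
  rw [stDeriv_apply, _root_.add_apply, liftB_Phi0_apply,
    _root_.sum_apply, fderiv_apply_eq_sum_partialDeriv
      ((hU.isSmooth_slice ht).isContDiff (by simp))]
  exact congrArg _ (Finset.sum_congr rfl fun i _ => (liftB_Phi_apply i _ a v).symm)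

/-- **Word bounds of all `∂ₜʲ` give bounds of all Fréchet derivatives of the space–time lift
within `[0, ∞) × ℝ³`** (induction on the order, over all value spaces: `‖D^{m+1}f‖ = ‖D^m(Df)‖`
and `Df` is the lift of `dt ⊗ ∂ₜU + ∑ᵢ dyᵢ ⊗ ∂ᵢU`, whose words of time derivatives are words of
those of `U`). -/
theorem liftB_iteratedFDerivWithin_bound :
    ∀ (m : ℕ) (G : Type) [NormedAddCommGroup G] [NormedSpace ℝ G] (U : ℝ → UnitAddTorus (Fin 3) → G),
      IsSmoothSpaceTimeOn (Ici 0) U →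
      (∀ (j : ℕ) (w : List (Fin 3)), ∃ C : ℝ, ∀ t ∈ Ici (0 : ℝ), ∀ x : UnitAddTorus (Fin 3),
        ‖wordDeriv w (((timeDerivWithin (Ici 0))^[j] U) t) x‖ ≤ C) →
      ∃ C : ℝ, ∀ t ∈ Ici (0 : ℝ), ∀ y : EuclideanSpace ℝ (Fin 3),
        ‖iteratedFDerivWithin ℝ m (stLift U) (Ici 0 ×ˢ univ) (t, y)‖ ≤ C := by
  intro m
  induction m with
  | zero =>
      intro G _ _ U _ hH
      obtain ⟨C, hC⟩ := hH 0 []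
      exact ⟨C, fun t ht y => by rw [norm_iteratedFDerivWithin_zero]; exact hC t ht (proj y)⟩
  | succ m ih =>
      intro G _ _ U hU hH
      have hS := uniqueDiffOn_Ici (0 : ℝ)
      -- the derivative field and its smoothness
      set Φ₀ : G →L[ℝ] (ℝ × EuclideanSpace ℝ (Fin 3) →L[ℝ] G) :=
        ContinuousLinearMap.smulRightL ℝ (ℝ × EuclideanSpace ℝ (Fin 3)) G (ContinuousLinearMap.fst ℝ ℝ (EuclideanSpace ℝ (Fin 3))) with hΦ₀
      set Φ : Fin 3 → G →L[ℝ] (ℝ × EuclideanSpace ℝ (Fin 3) →L[ℝ] G) := fun i =>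
        ContinuousLinearMap.smulRightL ℝ (ℝ × EuclideanSpace ℝ (Fin 3)) G
          ((EuclideanSpace.proj i).comp (ContinuousLinearMap.snd ℝ ℝ (EuclideanSpace ℝ (Fin 3)))) with hΦ
      set V : ℝ → UnitAddTorus (Fin 3) → (ℝ × EuclideanSpace ℝ (Fin 3) →L[ℝ] G) :=
        fun s x => Φ₀ (timeDerivWithin (Ici 0) U s x) + ∑ i, Φ i (partialDeriv i (U s) x) with hV
      have hA : IsSmoothSpaceTimeOn (Ici 0) (fun s x => Φ₀ (timeDerivWithin (Ici 0) U s x)) :=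
        (hU.timeDerivWithin hS).clm_comp Φ₀
      have hBi : ∀ i, IsSmoothSpaceTimeOn (Ici 0) (fun s x => Φ i (partialDeriv i (U s) x)) :=
        fun i => (hU.partialDeriv hS i).clm_comp (Φ i)
      have hB : IsSmoothSpaceTimeOn (Ici 0) (fun s x => ∑ i, Φ i (partialDeriv i (U s) x)) :=
        IsSmoothSpaceTimeOn.sum fun i _ => hBi i
      have hVs : IsSmoothSpaceTimeOn (Ici 0) V := hA.add hB
      -- the words of the time derivatives of `V`
      have hHV : ∀ (j : ℕ) (w : List (Fin 3)), ∃ C : ℝ, ∀ t ∈ Ici (0 : ℝ), ∀ x : UnitAddTorus (Fin 3),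
          ‖wordDeriv w (((timeDerivWithin (Ici 0))^[j] V) t) x‖ ≤ C := by
        intro j w
        obtain ⟨C₀, hC₀⟩ := hH (j + 1) w
        choose C₁ hC₁ using fun i : Fin 3 => hH j (w ++ [i])
        refine ⟨‖Φ₀‖ * C₀ + ∑ i, ‖Φ i‖ * C₁ i, fun t ht x => ?_⟩
        have hUj : IsSmooth (((timeDerivWithin (Ici 0))^[j] U) t) := (hU.iterate_timeDerivWithin hS j).isSmooth_slice ht
        have hUj1 : IsSmooth (((timeDerivWithin (Ici 0))^[j + 1] U) t) :=
          (hU.iterate_timeDerivWithin hS (j + 1)).isSmooth_slice ht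
        -- `∂ₜʲ V (t) = Φ₀ ∘ ∂ₜʲ⁺¹U(t) + ∑ᵢ Φᵢ ∘ ∂ᵢ ∂ₜʲU(t)` as functions on `T³`
        have e1 : ((timeDerivWithin (Ici 0))^[j] V) t = (⇑Φ₀ ∘ ((timeDerivWithin (Ici 0))^[j + 1] U) t) +
            fun x => ∑ i, (⇑(Φ i) ∘ partialDeriv i (((timeDerivWithin (Ici 0))^[j] U) t)) x := by
          funext x
          rw [hV, liftB_Titer_add hS hA hB j ht x, Pi.add_apply, liftB_Titer_clm hS (hU.timeDerivWithin hS) Φ₀ j ht x,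
            liftB_Titer_finset_sum hS Finset.univ (fun i _ => hBi i) j ht x, Function.comp_apply,
            ← iterate_succ_apply]
          refine congrArg _ (Finset.sum_congr rfl fun i _ => ?_)
          rw [Function.comp_apply, liftB_Titer_clm hS (hU.partialDeriv hS i) (Φ i) j ht x,
            liftB_Titer_partialDeriv_comm hU i j ht x]
        have hsA : IsSmooth (⇑Φ₀ ∘ ((timeDerivWithin (Ici 0))^[j + 1] U) t) := hUj1.comp_clm Φ₀
        have hsBi : ∀ i, IsSmooth (⇑(Φ i) ∘ partialDeriv i (((timeDerivWithin (Ici 0))^[j] U) t)) :=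
          fun i => (hUj.partialDeriv i).comp_clm (Φ i)
        have hsB : IsSmooth (fun x => ∑ i, (⇑(Φ i) ∘ partialDeriv i (((timeDerivWithin (Ici 0))^[j] U) t)) x) :=
          Literature.Analysis.FluidPDE.CompressibleEuler.isSmooth_fun_sum Finset.univ fun i _ => hsBi i
        rw [e1, wordDeriv_add hsA hsB w, Pi.add_apply, wordDeriv_clm_comp hUj1 Φ₀ w,
          liftB_wordDeriv_fun_sum Finset.univ (fun i _ => hsBi i) w]
        refine (norm_add_le _ _).trans (add_le_add ?_ ((norm_sum_le _ _).trans
          (Finset.sum_le_sum fun i _ => ?_)))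
        · rw [Function.comp_apply]
          exact (Φ₀.le_opNorm _).trans (mul_le_mul_of_nonneg_left (hC₀ t ht x) (norm_nonneg _))
        · rw [wordDeriv_clm_comp (hUj.partialDeriv i) (Φ i) w, Function.comp_apply,
            ← wordDeriv_concat]
          exact ((Φ i).le_opNorm _).trans (mul_le_mul_of_nonneg_left (hC₁ i t ht x) (norm_nonneg _))
      -- induction
      obtain ⟨C, hC⟩ := ih (ℝ × EuclideanSpace ℝ (Fin 3) →L[ℝ] G) V hVs hHV
      refine ⟨C, fun t ht y => ?_⟩
      have hs' : UniqueDiffOn ℝ (Ici (0 : ℝ) ×ˢ (univ : Set (EuclideanSpace ℝ (Fin 3)))) := hS.prod uniqueDiffOn_univ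
      have hz : ((t, y) : ℝ × EuclideanSpace ℝ (Fin 3)) ∈ Ici (0 : ℝ) ×ˢ (univ : Set (EuclideanSpace ℝ (Fin 3))) := ⟨ht, mem_univ _⟩
      have hEq : EqOn (fderivWithin ℝ (stLift U) (Ici 0 ×ˢ univ)) (stLift V) (Ici (0 : ℝ) ×ˢ univ) := by
        rintro ⟨s, z⟩ hsz
        rw [hV]
        exact liftB_fderivWithin_stLift hU (mem_prod.1 hsz).1 z
      rw [← norm_iteratedFDerivWithin_fderivWithin hs' hz, iteratedFDerivWithin_congr hEq hz]
      exact hC t ht y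

/-- On the open set `(0, ∞) × ℝ³` the honest iterated Fréchet derivative of a map `C^∞` on
`[0, ∞) × ℝ³` is the one within `[0, ∞) × ℝ³`. -/
theorem liftB_iteratedFDeriv_of_within {f : ℝ × EuclideanSpace ℝ (Fin 3) → G} (hf : ContDiffOn ℝ ∞ f (Ici 0 ×ˢ univ))
    (m : ℕ) {z : ℝ × EuclideanSpace ℝ (Fin 3)} (hz : z ∈ Ioi (0 : ℝ) ×ˢ (univ : Set (EuclideanSpace ℝ (Fin 3)))) :
    iteratedFDeriv ℝ m f z = iteratedFDerivWithin ℝ m f (Ici 0 ×ˢ univ) z := by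
  have hz' : z ∈ Ici (0 : ℝ) ×ˢ (univ : Set (EuclideanSpace ℝ (Fin 3))) := ⟨mem_Ici.2 (le_of_lt (mem_Ioi.1 (mem_prod.1 hz).1)), mem_univ _⟩
  have hnhds : Ici (0 : ℝ) ×ˢ (univ : Set (EuclideanSpace ℝ (Fin 3))) ∈ 𝓝 z :=
    mem_of_superset ((isOpen_Ioi.prod isOpen_univ).mem_nhds hz)
      (prod_mono Ioi_subset_Ici_self subset_rfl)
  exact (iteratedFDerivWithin_eq_iteratedFDeriv ((uniqueDiffOn_Ici 0).prod uniqueDiffOn_univ)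
    ((hf.contDiffAt hnhds).of_le (by exact_mod_cast le_top)) hz').symm

end Lift

/-! ## The stub -/

/-- Stub B3 of the line `SketchIdeator2`: **all space–time derivatives of the lifts are bounded on
`(0, ∞) × ℝ³`**. For a forward classical solution of the Navier–Stokes equations on `T³` with a
steady smooth (solenoidal, mean-zero) force and `sup_{t ≥ 0} E_k(u(t)) < ∞` for all `k`, every
`‖D^m (stLift u)‖` and every `‖D^m (stLift p̃)‖`, `p̃ = p − p(·, 0)`, is bounded on `Ioi 0 ×ˢ univ`.
(Foias–Manley–Rosa–Temam 2001, Ch. II §A.5; Constantin–Foias 1988, Ch. 13.) The positivity of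
`ν`, the solenoidality and mean of the force and the mean of `u` are not used. -/
theorem stub_liftBounds :
    ∀ (ν : ℝ) (F : UnitAddTorus (Fin 3) → EuclideanSpace ℝ (Fin 3))
      (u : ℝ → UnitAddTorus (Fin 3) → EuclideanSpace ℝ (Fin 3)) (p : ℝ → UnitAddTorus (Fin 3) → ℝ),
      0 < ν → IsSmooth F → IsDivFree F → HasZeroMean F →
      IsClassicalNSSolutionOn (Set.Ici 0) ν (fun _ => F) u p →
      (∀ t : ℝ, 0 ≤ t → HasZeroMean (u t)) →
      (∀ k : ℕ, ∃ C : ℝ, ∀ t : ℝ, 0 ≤ t → sobolevEnergy k (u t) ≤ C) →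
      (∀ m : ℕ, ∃ C : ℝ, ∀ z ∈ Set.Ioi (0 : ℝ) ×ˢ (Set.univ : Set (EuclideanSpace ℝ (Fin 3))),
          ‖iteratedFDeriv ℝ m (stLift u) z‖ ≤ C) ∧
      (∀ m : ℕ, ∃ C : ℝ, ∀ z ∈ Set.Ioi (0 : ℝ) ×ˢ (Set.univ : Set (EuclideanSpace ℝ (Fin 3))),
          ‖iteratedFDeriv ℝ m (stLift (fun t x => p t x - p t 0)) z‖ ≤ C) := by
  intro ν F u p _hν hF _hdiv _hmean hsol _hzm h0
  have hsolq : IsClassicalNSSolutionOn (Ici 0) ν (fun _ => F) u (fun t x => p t x - p t 0) :=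
    hsol.sub_pressure_apply 0
  refine ⟨fun m => ?_, fun m => ?_⟩
  · obtain ⟨C, hC⟩ := liftB_iteratedFDerivWithin_bound m (EuclideanSpace ℝ (Fin 3)) u hsol.smooth_velocity
      (liftB_sup_words_velocity hsol hF h0)
    refine ⟨C, fun z hz => ?_⟩
    obtain ⟨t, y⟩ := z
    rw [liftB_iteratedFDeriv_of_within hsol.smooth_velocity m hz]
    exact hC t (mem_Ici.2 (le_of_lt (mem_Ioi.1 (mem_prod.1 hz).1))) y
  · obtain ⟨C, hC⟩ := liftB_iteratedFDerivWithin_bound m ℝ (fun t x => p t x - p t 0)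
      hsolq.smooth_pressure (liftB_pressure_words hsolq hF h0 (fun s => sub_self _))
    refine ⟨C, fun z hz => ?_⟩
    obtain ⟨t, y⟩ := z
    rw [liftB_iteratedFDeriv_of_within hsolq.smooth_pressure m hz]
    exact hC t (mem_Ici.2 (le_of_lt (mem_Ioi.1 (mem_prod.1 hz).1))) y

end Summit.AnomalousDissipation.AnomalousDissipation.Theorems.ChainRealisation.SeparatrixFluxPinning

end
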